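import Literature.Probability.Percolation.KestenScalingThetaFromKernel
import Literature.Probability.Percolation.RhombusPivotalSumAlt
import Literature.Probability.Percolation.AltFourArmGlue
import Literature.Probability.Percolation.KestenScalingProofs
import HarnessLib

/-!
# `θ(p) ≍ π₁(L_ε(p))` from near-critical ALTERNATING four-arm separation (assembly, proofs only)

Topic `Literature/Probability/Percolation`; family `crit-perc`, statement **crit-perc.S16**.
PROOFS ONLY (no definition, no named fact). Seventh proof file of the named fact
`Literature.Probability.Percolation.Nolin2008_theta_asymp` (`KestenScaling.lean`; P. Nolin,
*Near-critical percolation in two dimensions*, EJP 13 (2008), §7.4, Cor. 41 with eq. (7.25)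
[arXiv 0711.4948: Cor. 39 and the display following it]: for `p > 1/2`,
`θ(p) ≍ P_p(0 ↔ ∂S_{L(p)}) ≍ P_{1/2}(0 ↔ ∂S_{L(p)}) = π₁(L(p))`), after
`KestenScalingThetaProofs.lean`, `CharLengthEquivalence.lean`, `KestenScalingThetaFrom{Facts,FourFacts,TwoFacts,Kernel}.lean`.

## Why this file

The tree's near-critical arm calculus is now developed, as in the literature (Kesten 1987; Nolin
2008, §4 for one colour sequence `σ`; Werner 2009, Lecture 6 for the alternating `π̂_p`), for the
ALTERNATING four-arm event in cluster form `altFourArm` / `altFourArmProbAt` (`AltFourArm.lean`):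
quasi-multiplicativity from alternating separation (`altFourArm_quasiMult_of_altSeparation`,
`AltFourArmGlue.lean`), the rhombus pivotal count (`rhombusPivotalSum_lower_alt_of_altSeparation`,
`KestenRelationRussoAlt.lean`; `rhombusPivotalSum_upper_alt`, `RhombusPivotalSumAlt.lean`), Nolin's
Thm. 27 for one arm (`Nolin2008_thm27_oneArm_of_altHyps`, `NearCriticalOneArmFromAltFacts.lean`).
`KestenScalingThetaFromKernel.lean` proved `Nolin2008_theta_asymp_of_altHyps` from FIVE alternating
hypotheses (quasi-multiplicativity, a priori lower bound, interior pivotal lower bound for Werner's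
parallelogram, and the two one-sided Kesten bounds with the critical alternating kernel). This file
closes the remaining gaps INSIDE the alternating route — Kesten's relation and Cor. 41 with the
alternating kernel — so that `Nolin2008_theta_asymp` (and, on the way, `Nolin2008_cor41`) follow
from the one-arm stability below `L(p)` and exactly THREE displayed statements about Werner's
alternating `π̂` below `L(p)` (of which the one-arm stability is itself a consequence):

* `(hsepA)` near-critical four-arm separation for the alternating pattern —
  `c · π̂^alt_t(n, N) ≤ P_t(sepFourArm n N)` for `n₀ ≤ n`, `2n ≤ N ≤ L(t, ε)`, `t ∈ [1/2, 1/2 + δ)`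
  (Nolin 2008, Thm. 11 for `j = 4`, `σ = BWBW` [arXiv 0711.4948: Thm. 10]; Werner 2009, Prop. 6.1;
  Kesten 1987, Lemmas 4–6) — the single deep input of the whole calculus;
* `(hLB)` the a priori lower bound `c (m/n)^{2-β} ≤ π̂^alt_t(m, n)` below `L(p)` (Werner 2009,
  Lecture 6, §3, third estimate; Nolin 2008, Thm. 24 (ii) with Reimer's inequality);
* `(hS)` the near-critical stability of `π̂^alt` below `L(p)`,
  `c π̂^alt_{1/2}(r₀, N) ≤ π̂^alt_t(r₀, N) ≤ C π̂^alt_{1/2}(r₀, N)` (Werner 2009, Lemma 6.3 as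
  printed; Nolin 2008, Thm. 27 for `j = 4`, `σ = BWBW`).

## Contents

* `kesten_upper_of_lt_half_gen`, `kesten_lower_of_lt_half_gen`,
  `kesten_upper_at_of_pivotal_lower_gen`, `kesten_lower_at_of_pivotal_upper_gen` — **Kesten's
  relation by Russo integration for an arbitrary non-negative kernel**: the four lemmas of
  `KestenScalingProofs.lean` (`KestenScalingProofs.upper/lower_of_lt_half`,
  `Nolin2008_prop34_upper_at_of_pivotal_lower`, `Nolin2008_prop34_lower_at_of_pivotal_upper`)
  verbatim, with the critical order-free `π₄(r₀, N) = critFourArmProb r₀ N` replaced by any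
  `Q r₀ N ≥ 0` (Nolin 2008, §7.3, proof of Prop. 34 and Remark 35; Werner 2009, Cor. 6.3 and the
  display after Lemma 6.3: `∫_{p}^{1/2} Σ_v P_s(v pivotal for 𝒞_H([0,N]²)) ds = 1/2 - P_p(𝒞_H)` at
  `N = L_ε(p)`, self-duality `BollobasRiordan2006_ch5_lemma7_holds`, sub-critical decay
  `BollobasRiordan2006_tri_expDecay_holds`).
* `altRhombusPivotal_of_altSeparation` — the two-sided rhombus pivotal count with the CRITICAL
  alternating kernel, `Σ_{v ∈ [0,N]²} P_t(v pivotal) ≍ N² π̂^alt_{1/2}(r₀, N)` for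
  `1/2 ≤ t < 1/2 + δ`, `n₁ ≤ N ≤ L(t, ε)`, from `(hsepA)`, `(hLB)`, `(hS)`
  (`rhombusPivotalSum_lower_alt_of_altSeparation`, `rhombusPivotalSum_upper_alt`,
  `altRhombusPivotal_of_altLemma62_of_altLemma63`);
* `altRhombusPivotal_twoSided_nolin` — the same on BOTH sides of `1/2` and below Nolin's rhombus
  length `L_ε(t) = charLength ε t` at EVERY level `ε > 0` (symmetry `rhombusPivotalSum_symm`,
  `charLength_symm`, and `L_ε(t) ≤ L(t, ε')` for `ε' ≤ ε`, `charLength_le_charLengthW_of_le`);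
* `kestenBounds_alt_of_altRhombusPivotal` — **Kesten's relation with the critical alternating
  kernel**: `|p - 1/2| L_ε(p)² π̂^alt_{1/2}(r₀, L_ε(p)) ≤ C` for `ε < 1/2` and `≥ c(ε) > 0` for every
  `ε ∈ (0, 1/2)`, `p ≠ 1/2` near `1/2` — the hypotheses `hKup`, `hKlow` of
  `Nolin2008_theta_asymp_of_kernel` / `Nolin2008_cor41_of_kernel` (`KestenScalingThetaFromKernel.lean`);
* `Nolin2008_cor41_of_altSeparation` — **Cor. 41 at every `ε ∈ (0, 1/2)` from `(hsepA)`, `(hLB)`,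
  `(hS)`**;
* `Nolin2008_theta_asymp_of_oneArm_of_altSeparation` — **`θ ≍ π₁(L_ε)` at every `ε ∈ (0, 1/2)` from
  the one-arm stability `Werner2009_oneArm_nearCritical` and `(hsepA)`, `(hLB)`, `(hS)`**; the
  one-arm stability being itself a consequence of `(hsepA)`, `(hLB)`
  (`Werner2009_oneArm_nearCritical_of_altSeparation`, `WernerOneArmStabilityFromAltSeparation.lean`,
  fleet 2026-08-15 — not imported here to keep the imports light), the fact rests on the three
  displayed alternating statements.

The discharge `Nolin2008_theta_asymp_holds` is
`Nolin2008_theta_asymp_of_oneArm_of_altSeparation (Werner2009_oneArm_nearCritical_of_altSeparation hsepA hLB) hsepA hLB hS`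
once the three statements are theorems of the tree (the separation theorem for `j = 4` below
`L(p)` being the deep one; at `p = 1/2`, `j = 2` it is the tree's `Nolin2008_twoArm_separation_holds`).

## References

* P. Nolin, Near-critical percolation in two dimensions, *Electron. J. Probab.* 13 (2008)
  1562–1623: §4.3 Thm. 11, Prop. 12–13, §4.5 Prop. 17, §5.2 Thm. 24, §6.1 Thm. 27, §7.3 Prop. 34,
  Remark 35, Cor. 37, §7.4 Lemma 39, Cor. 41, eq. (7.25) (arXiv 0711.4948: Thm. 10, Prop. 11–12,
  Prop. 16, Thm. 23, Thm. 26, Prop. 32, Remark 34, Cor. 35, Lemma 37, Cor. 39) [Nolin2008].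
* W. Werner, *Lectures on two-dimensional critical percolation*, IAS/Park City Math. Ser. 16
  (2009), Lecture 6, §3 (a priori estimates), §4 Prop. 6.1, Cor. 6.2, Lemma 6.2, Cor. 6.3,
  Lemma 6.3, §5 and "End of the proof" (arXiv 0710.0856, pp. 43–48) [WernerPCMI2009].
* H. Kesten, Scaling relations for 2D-percolation, *Comm. Math. Phys.* 109 (1987) 109–156,
  Lemmas 4–6, 8, (4.5), Thms. 1–2 [KestenScalingCMP1987].

Tree: `Nolin2008_theta_asymp_of_kernel`, `Nolin2008_cor41_of_kernel`, `critAltFourArmProb_quasiMult`,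
`critAltFourArmProb_lowerBound` (`KestenScalingThetaFromKernel.lean`),
`Nolin2008_theta_asymp_of_oneArm_nearCritical` (`KestenScalingThetaProofs.lean`),
`Werner2009_oneArm_nearCritical` (`WernerCorrelationLength.lean`),
`altFourArm_quasiMult_of_altSeparation` (`AltFourArmGlue.lean`),
`rhombusPivotalSum_lower_alt_of_altSeparation`, `altRhombusPivotal_of_altLemma62_of_altLemma63`
(`KestenRelationRussoAlt.lean`), `rhombusPivotalSum_upper_alt`, `charLength_le_charLengthW_of_le`
(`RhombusPivotalSumAlt.lean`, `RhombusPivotalSumBounds.lean`), `rhombusPivotalSum`,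
`hasDerivAt_triLRCrossingProb`, `charLength_le_charLength`, `le_charLength_eventually`,
`triLRCrossingProb_charLength_le'` (`KestenRelationRusso.lean`), `rhombusPivotalSum_symm`,
`BollobasRiordan2006_ch5_lemma7_holds`, `Nolin2008_subcritical_crossing_of_expDecay`
(`KestenRelationRussoProofs.lean`), `BollobasRiordan2006_tri_expDecay_holds`
(`TriSubcriticalCrossingProofs.lean`), `charLength_symm` (`KestenScaling.lean`),
`altFourArmProbAt_nonneg`. Mathlib: `Convex.mul_sub_le_image_sub_of_le_deriv`,
`Convex.image_sub_le_mul_sub_of_deriv_le`, `Set.projIcc`.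
-/

noncomputable section

open Filter Topology MeasureTheory Set
open scoped unitInterval

namespace Literature.Probability.Percolation

open LatticeModels

/-! ### Kesten's relation by Russo integration, for any non-negative kernel

The four lemmas of `KestenScalingProofs.lean` with `critFourArmProb r₀ N` replaced by an arbitrary
`Q r₀ N ≥ 0`; the proofs are verbatim. -/

/-- **Upper bound of Kesten's relation from the lower pivotal bound, `p < 1/2`, generic kernel** (the tree's `KestenScalingProofs.upper_of_lt_half` with `π₄(r₀, N)` replaced by any `Q N ≥ 0`) (Nolin 2008,
Remark 35 [arXiv: Remark 34]: "the upper bound can be obtained directly from Russo's formula";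
Werner 2009, Lecture 6, Cor. 6.3: integrating `c N² π₄(N) ≤ d/dt P_t(𝒞_H([0,N]²))` over
`[p, 1/2]` at `N = L_ε(p)` gives `c N² π₄(N) (1/2 - p) ≤ P_{1/2} - P_p ≤ 1/2`). The self-duality
`P_{1/2}(𝒞_H([0,N]²)) = 1/2` and the sub-critical decay making `L_ε` a minimum are the tree's
theorems `BollobasRiordan2006_ch5_lemma7_holds`, `BollobasRiordan2006_tri_expDecay_holds`. [cite: Nolin2008, §7.3, proof of Prop. 34 and Remark 35 (arXiv 0711.4948: Prop. 32, Remark 34)] [cite: WernerPCMI2009, Lecture 6, Cor. 6.3] -/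
theorem kesten_upper_of_lt_half_gen {ε : ℝ} (hε : 0 < ε) {Q : ℕ → ℝ} (hQ0 : ∀ N, 0 ≤ Q N)
    {n₁ : ℕ} {δ c : ℝ} (hc : 0 < c)
    (hlow : ∀ t : unitInterval, |(t : ℝ) - 1 / 2| < δ →
      ∀ N : ℕ, n₁ ≤ N → ((t : ℝ) ≠ 1 / 2 → N ≤ charLength ε t) →
        c * ((N : ℝ) ^ 2 * Q N) ≤ rhombusPivotalSum t N)
    {δ' : ℝ} (hδ'δ : δ' ≤ δ) (hδ'4 : δ' ≤ 1 / 4)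
    (hL : ∀ p : unitInterval, 1 / 2 - δ' < (p : ℝ) → (p : ℝ) < 1 / 2 → n₁ ≤ charLength ε p)
    {p : unitInterval} (hp : (p : ℝ) < 1 / 2) (hpδ : |(p : ℝ) - 1 / 2| < δ') :
    |(p : ℝ) - 1 / 2| * (charLength ε p : ℝ) ^ 2 * Q (charLength ε p) ≤
      1 / (2 * c) := by
  have h7 : BollobasRiordan2006_ch5_lemma7 := BollobasRiordan2006_ch5_lemma7_holds
  have hsub : Nolin2008_subcritical_crossing :=
    Nolin2008_subcritical_crossing_of_expDecay BollobasRiordan2006_tri_expDecay_holds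
  set N : ℕ := charLength ε p with hN
  have hp1 : 1 / 2 - δ' < (p : ℝ) := by
    have := (abs_sub_lt_iff.1 hpδ).2; linarith
  have hp0 : 0 < (p : ℝ) := by linarith
  have hn₁ : n₁ ≤ N := hL p hp1 hp
  -- the crossing probability as a function of a real parameter
  set f : ℝ → ℝ := fun r => triLRCrossingProb (projIcc (0 : ℝ) 1 zero_le_one r) N N with hf
  have hfhalf : f (1 / 2) = 1 / 2 := by
    have hproj : projIcc (0 : ℝ) 1 zero_le_one (1 / 2) = half :=
      Subtype.ext (by rw [projIcc_of_mem zero_le_one ⟨by norm_num, by norm_num⟩]; rfl)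
    simp only [hf, hproj, h7 N]
  have hfp0 : 0 ≤ f p := measureReal_nonneg
  -- derivative on `[p, 1/2]` and the lower pivotal bound there
  set D : Set ℝ := Icc (p : ℝ) (1 / 2) with hD
  have hIoo : ∀ q ∈ D, q ∈ Ioo (0 : ℝ) 1 :=
    fun q hq => ⟨hp0.trans_le hq.1, hq.2.trans_lt (by norm_num)⟩
  have hderiv : ∀ q ∈ D,
      HasDerivAt f (rhombusPivotalSum (projIcc (0 : ℝ) 1 zero_le_one q) N) q :=
    fun q hq => hasDerivAt_triLRCrossingProb N (hIoo q hq)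
  have hcont : ContinuousOn f D := fun q hq => (hderiv q hq).continuousAt.continuousWithinAt
  have hdiff : DifferentiableOn ℝ f (interior D) := fun q hq =>
    (hderiv q (interior_subset hq)).differentiableAt.differentiableWithinAt
  have hbound : ∀ q ∈ interior D, c * ((N : ℝ) ^ 2 * Q N) ≤ deriv f q := by
    intro q hq
    rw [hD, interior_Icc] at hq
    rw [(hderiv q (Ioo_subset_Icc_self hq)).deriv]
    set t : unitInterval := projIcc (0 : ℝ) 1 zero_le_one q with ht
    have htq : (t : ℝ) = q := by
      rw [ht, projIcc_of_mem zero_le_one ⟨(hp0.trans hq.1).le, (hq.2.trans (by norm_num)).le⟩]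
    have ht1 : |(t : ℝ) - 1 / 2| < δ := by
      rw [htq, abs_sub_lt_iff]; constructor <;> linarith [hq.1, hq.2]
    have ht2 : (t : ℝ) ≠ 1 / 2 → N ≤ charLength ε t := fun _ =>
      charLength_le_charLength hsub hε (Subtype.coe_le_coe.1 (by rw [htq]; exact hq.1.le))
        (by rw [htq]; exact hq.2)
    exact hlow t ht1 N hn₁ ht2
  have hpD : (p : ℝ) ∈ D := ⟨le_rfl, hp.le⟩
  have hhD : (1 / 2 : ℝ) ∈ D := ⟨hp.le, le_rfl⟩
  -- mean value inequality: `c · X · (1/2 - p) ≤ f(1/2) - f(p) ≤ 1/2`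
  have hmv := (convex_Icc (p : ℝ) (1 / 2)).mul_sub_le_image_sub_of_le_deriv hcont hdiff
    hbound _ hpD _ hhD hp.le
  rw [hfhalf] at hmv
  have habs : |(p : ℝ) - 1 / 2| = 1 / 2 - p := by
    rw [abs_sub_comm]; exact abs_of_nonneg (by linarith)
  have hX0 : 0 ≤ (N : ℝ) ^ 2 * Q N := by
    have : 0 ≤ Q N := hQ0 N
    positivity
  rw [habs, le_div_iff₀ (by positivity)]
  nlinarith [hmv, hfp0, hX0]

/-- **Lower bound of Kesten's relation from the upper pivotal bound, `p < 1/2`, generic kernel** (the tree's `KestenScalingProofs.lower_of_lt_half` with `π₄(r₀, N)` replaced by any `Q N ≥ 0`) (Nolin 2008,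
proof of Prop. 34: "by construction of `L(p)`, the variation of the crossing event is of order
`1`"; Werner 2009, Lecture 6, display after Lemma 6.3: integrating
`d/dt P_t(𝒞_H([0,N]²)) ≤ C N² π₄(N)` over `[p, 1/2]` at `N = L_ε(p)`, where `P_p ≤ ε` and
`P_{1/2} = 1/2`, gives `1/2 - ε ≤ C N² π₄(N) (1/2 - p)`). [cite: Nolin2008, §7.3, proof of Prop. 34 (arXiv 0711.4948: Prop. 32)] [cite: WernerPCMI2009, Lecture 6, display after Lemma 6.3] -/
theorem kesten_lower_of_lt_half_gen {ε : ℝ} (hε : 0 < ε) {Q : ℕ → ℝ} (hQ0 : ∀ N, 0 ≤ Q N)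
    {n₁ : ℕ} {δ C : ℝ}
    (hup : ∀ t : unitInterval, |(t : ℝ) - 1 / 2| < δ →
      ∀ N : ℕ, n₁ ≤ N → ((t : ℝ) ≠ 1 / 2 → N ≤ charLength ε t) →
        rhombusPivotalSum t N ≤ C * ((N : ℝ) ^ 2 * Q N))
    {δ' : ℝ} (hδ'δ : δ' ≤ δ) (hδ'4 : δ' ≤ 1 / 4)
    (hL : ∀ p : unitInterval, 1 / 2 - δ' < (p : ℝ) → (p : ℝ) < 1 / 2 → n₁ ≤ charLength ε p)
    {p : unitInterval} (hp : (p : ℝ) < 1 / 2) (hpδ : |(p : ℝ) - 1 / 2| < δ') :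
    (1 / 2 - ε) / max C 1 ≤
      |(p : ℝ) - 1 / 2| * (charLength ε p : ℝ) ^ 2 * Q (charLength ε p) := by
  have h7 : BollobasRiordan2006_ch5_lemma7 := BollobasRiordan2006_ch5_lemma7_holds
  have hsub : Nolin2008_subcritical_crossing :=
    Nolin2008_subcritical_crossing_of_expDecay BollobasRiordan2006_tri_expDecay_holds
  set N : ℕ := charLength ε p with hN
  have hp1 : 1 / 2 - δ' < (p : ℝ) := by
    have := (abs_sub_lt_iff.1 hpδ).2; linarith
  have hp0 : 0 < (p : ℝ) := by linarith
  have hn₁ : n₁ ≤ N := hL p hp1 hp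
  -- the crossing probability as a function of a real parameter
  set f : ℝ → ℝ := fun r => triLRCrossingProb (projIcc (0 : ℝ) 1 zero_le_one r) N N with hf
  have hfhalf : f (1 / 2) = 1 / 2 := by
    have hproj : projIcc (0 : ℝ) 1 zero_le_one (1 / 2) = half :=
      Subtype.ext (by rw [projIcc_of_mem zero_le_one ⟨by norm_num, by norm_num⟩]; rfl)
    simp only [hf, hproj, h7 N]
  have hfp : f p ≤ ε := by
    simp only [hf, projIcc_val zero_le_one p]
    exact triLRCrossingProb_charLength_le' hsub hε hp
  -- derivative on `[p, 1/2]` and the upper pivotal bound there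
  set D : Set ℝ := Icc (p : ℝ) (1 / 2) with hD
  have hIoo : ∀ q ∈ D, q ∈ Ioo (0 : ℝ) 1 :=
    fun q hq => ⟨hp0.trans_le hq.1, hq.2.trans_lt (by norm_num)⟩
  have hderiv : ∀ q ∈ D,
      HasDerivAt f (rhombusPivotalSum (projIcc (0 : ℝ) 1 zero_le_one q) N) q :=
    fun q hq => hasDerivAt_triLRCrossingProb N (hIoo q hq)
  have hcont : ContinuousOn f D := fun q hq => (hderiv q hq).continuousAt.continuousWithinAt
  have hdiff : DifferentiableOn ℝ f (interior D) := fun q hq =>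
    (hderiv q (interior_subset hq)).differentiableAt.differentiableWithinAt
  have hbound : ∀ q ∈ interior D, deriv f q ≤ max C 1 * ((N : ℝ) ^ 2 * Q N) := by
    intro q hq
    rw [hD, interior_Icc] at hq
    rw [(hderiv q (Ioo_subset_Icc_self hq)).deriv]
    set t : unitInterval := projIcc (0 : ℝ) 1 zero_le_one q with ht
    have htq : (t : ℝ) = q := by
      rw [ht, projIcc_of_mem zero_le_one ⟨(hp0.trans hq.1).le, (hq.2.trans (by norm_num)).le⟩]
    have ht1 : |(t : ℝ) - 1 / 2| < δ := by
      rw [htq, abs_sub_lt_iff]; constructor <;> linarith [hq.1, hq.2]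
    have ht2 : (t : ℝ) ≠ 1 / 2 → N ≤ charLength ε t := fun _ =>
      charLength_le_charLength hsub hε (Subtype.coe_le_coe.1 (by rw [htq]; exact hq.1.le))
        (by rw [htq]; exact hq.2)
    refine (hup t ht1 N hn₁ ht2).trans ?_
    exact mul_le_mul_of_nonneg_right (le_max_left C 1)
      (mul_nonneg (sq_nonneg _) (hQ0 N))
  have hpD : (p : ℝ) ∈ D := ⟨le_rfl, hp.le⟩
  have hhD : (1 / 2 : ℝ) ∈ D := ⟨hp.le, le_rfl⟩
  -- mean value inequality: `1/2 - ε ≤ f(1/2) - f(p) ≤ max C 1 · X · (1/2 - p)`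
  have hmv := (convex_Icc (p : ℝ) (1 / 2)).image_sub_le_mul_sub_of_deriv_le hcont hdiff
    hbound _ hpD _ hhD hp.le
  rw [hfhalf] at hmv
  have habs : |(p : ℝ) - 1 / 2| = 1 / 2 - p := by
    rw [abs_sub_comm]; exact abs_of_nonneg (by linarith)
  have hX0 : 0 ≤ (N : ℝ) ^ 2 * Q N := by
    have : 0 ≤ Q N := hQ0 N
    positivity
  have hmax : 0 < max C 1 := lt_max_of_lt_right one_pos
  rw [habs, div_le_iff₀ hmax]
  nlinarith [hmv, hfp, hX0]

/-- **Upper bound of Kesten's relation from the lower pivotal count, at a fixed `ε`, generic kernel** (the tree's `Nolin2008_prop34_upper_at_of_pivotal_lower` with `π₄(r₀, N)` replaced by any `Q r₀ N ≥ 0`) (Nolin 2008,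
Remark 35 [arXiv: Remark 34]; Werner 2009, Lecture 6, Cor. 6.3: "for all `p > 1/2`,
`(p - 1/2) × L(p)² π̂_p(L(p)) ≤ 1`"): if for every large inner radius `r₀` the lower pivotal bound
`c N² π₄(N) ≤ Σ_{v ∈ [0,N]²} P_t(v pivotal)` holds for `t` near `1/2` and `n₁ ≤ N ≤ L_ε(t)`, then
`|p - 1/2| L_ε(p)² π₄(L_ε(p)) ≤ C` on a punctured neighbourhood of `1/2` (the case `p > 1/2`
being the case `1 - p`, `L_ε(p) = L_ε(1 - p)`). [cite: Nolin2008, §7.3, Remark 35 (arXiv 0711.4948: Remark 34)] [cite: WernerPCMI2009, Lecture 6, Cor. 6.3] -/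
theorem kesten_upper_at_of_pivotal_lower_gen {ε : ℝ} (hε : 0 < ε) (hε' : ε < 1 / 2)
    {Q : ℕ → ℕ → ℝ} (hQ0 : ∀ r N, 0 ≤ Q r N)
    (hlow : ∃ r₁ : ℕ, ∀ r₀ ≥ r₁, ∃ n₁ : ℕ, ∃ δ > (0 : ℝ), ∃ c > (0 : ℝ),
      ∀ t : unitInterval, |(t : ℝ) - 1 / 2| < δ →
        ∀ N : ℕ, n₁ ≤ N → ((t : ℝ) ≠ 1 / 2 → N ≤ charLength ε t) →
          c * ((N : ℝ) ^ 2 * Q r₀ N) ≤ rhombusPivotalSum t N) :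
    ∃ r₁ : ℕ, ∀ r₀ ≥ r₁, ∃ δ > (0 : ℝ), ∃ C : ℝ,
      ∀ p : unitInterval, (p : ℝ) ≠ 1 / 2 → |(p : ℝ) - 1 / 2| < δ →
        |(p : ℝ) - 1 / 2| * (charLength ε p : ℝ) ^ 2 * Q r₀ (charLength ε p) ≤ C := by
  have h7 : BollobasRiordan2006_ch5_lemma7 := BollobasRiordan2006_ch5_lemma7_holds
  have hsub : Nolin2008_subcritical_crossing :=
    Nolin2008_subcritical_crossing_of_expDecay BollobasRiordan2006_tri_expDecay_holds
  obtain ⟨r₁, hr₁⟩ := hlow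
  refine ⟨r₁, fun r₀ hr₀ => ?_⟩
  obtain ⟨n₁, δ, hδ, c, hc, hb⟩ := hr₁ r₀ hr₀
  obtain ⟨δL, hδL, hL⟩ := le_charLength_eventually h7 hsub hε hε' n₁
  set δ' : ℝ := min (min δ δL) (1 / 4) with hδ'
  have hδ'δ : δ' ≤ δ := (min_le_left _ _).trans (min_le_left _ _)
  have hδ'L : δ' ≤ δL := (min_le_left _ _).trans (min_le_right _ _)
  have hδ'4 : δ' ≤ 1 / 4 := min_le_right _ _
  have hδ'0 : 0 < δ' := lt_min (lt_min hδ hδL) (by norm_num)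
  have hL' : ∀ p : unitInterval, 1 / 2 - δ' < (p : ℝ) → (p : ℝ) < 1 / 2 → n₁ ≤ charLength ε p :=
    fun p h1 h2 => hL p (by linarith) h2
  refine ⟨δ', hδ'0, 1 / (2 * c), fun p hne hpδ => ?_⟩
  rcases lt_or_gt_of_ne hne with hp | hp
  · exact kesten_upper_of_lt_half_gen hε (hQ0 r₀) hc hb hδ'δ hδ'4 hL' hp hpδ
  · -- `p > 1/2`: apply the previous case to `1 - p`
    have hq : ((σ p : unitInterval) : ℝ) < 1 / 2 := by
      rw [unitInterval.coe_symm_eq]; linarith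
    have hqδ : |((σ p : unitInterval) : ℝ) - 1 / 2| < δ' := by
      rw [unitInterval.coe_symm_eq, show (1 : ℝ) - p - 1 / 2 = -((p : ℝ) - 1 / 2) by ring,
        abs_neg]
      exact hpδ
    have h := kesten_upper_of_lt_half_gen hε (hQ0 r₀) hc hb hδ'δ hδ'4 hL' hq hqδ
    rw [charLength_symm, unitInterval.coe_symm_eq,
      show (1 : ℝ) - p - 1 / 2 = -((p : ℝ) - 1 / 2) by ring, abs_neg] at h
    exact h

/-- **Lower bound of Kesten's relation from the upper pivotal count, at a fixed `ε`, generic kernel** (the tree's `Nolin2008_prop34_lower_at_of_pivotal_upper` with `π₄(r₀, N)` replaced by any `Q r₀ N ≥ 0`) (Nolin 2008,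
proof of Prop. 34 [arXiv: Prop. 32]; Werner 2009, Lecture 6, display after Lemma 6.3:
`(p₀ - 1/2) L(p₀)² π̂_{1/2}(L(p₀)) ≥ h_{p₀}(L(p₀)) - h_{1/2}(L(p₀))`, "this lower bound is also
bounded from below … because of the definition of `L(p)`"): if for every large inner radius `r₀`
the upper pivotal bound `Σ_{v ∈ [0,N]²} P_t(v pivotal) ≤ C N² π₄(N)` holds for `t` near `1/2` and
`n₁ ≤ N ≤ L_ε(t)`, then `c ≤ |p - 1/2| L_ε(p)² π₄(L_ε(p))` with `c > 0` on a punctured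
neighbourhood of `1/2`. [cite: Nolin2008, §7.3, proof of Prop. 34 (arXiv 0711.4948: Prop. 32)] [cite: WernerPCMI2009, Lecture 6, display after Lemma 6.3] -/
theorem kesten_lower_at_of_pivotal_upper_gen {ε : ℝ} (hε : 0 < ε) (hε' : ε < 1 / 2)
    {Q : ℕ → ℕ → ℝ} (hQ0 : ∀ r N, 0 ≤ Q r N)
    (hup : ∃ r₁ : ℕ, ∀ r₀ ≥ r₁, ∃ n₁ : ℕ, ∃ δ > (0 : ℝ), ∃ C : ℝ,
      ∀ t : unitInterval, |(t : ℝ) - 1 / 2| < δ →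
        ∀ N : ℕ, n₁ ≤ N → ((t : ℝ) ≠ 1 / 2 → N ≤ charLength ε t) →
          rhombusPivotalSum t N ≤ C * ((N : ℝ) ^ 2 * Q r₀ N)) :
    ∃ r₁ : ℕ, ∀ r₀ ≥ r₁, ∃ δ > (0 : ℝ), ∃ c > (0 : ℝ),
      ∀ p : unitInterval, (p : ℝ) ≠ 1 / 2 → |(p : ℝ) - 1 / 2| < δ →
        c ≤ |(p : ℝ) - 1 / 2| * (charLength ε p : ℝ) ^ 2 * Q r₀ (charLength ε p) := by
  have h7 : BollobasRiordan2006_ch5_lemma7 := BollobasRiordan2006_ch5_lemma7_holds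
  have hsub : Nolin2008_subcritical_crossing :=
    Nolin2008_subcritical_crossing_of_expDecay BollobasRiordan2006_tri_expDecay_holds
  obtain ⟨r₁, hr₁⟩ := hup
  refine ⟨r₁, fun r₀ hr₀ => ?_⟩
  obtain ⟨n₁, δ, hδ, C, hb⟩ := hr₁ r₀ hr₀
  obtain ⟨δL, hδL, hL⟩ := le_charLength_eventually h7 hsub hε hε' n₁
  set δ' : ℝ := min (min δ δL) (1 / 4) with hδ'
  have hδ'δ : δ' ≤ δ := (min_le_left _ _).trans (min_le_left _ _)
  have hδ'L : δ' ≤ δL := (min_le_left _ _).trans (min_le_right _ _)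
  have hδ'4 : δ' ≤ 1 / 4 := min_le_right _ _
  have hδ'0 : 0 < δ' := lt_min (lt_min hδ hδL) (by norm_num)
  have hL' : ∀ p : unitInterval, 1 / 2 - δ' < (p : ℝ) → (p : ℝ) < 1 / 2 → n₁ ≤ charLength ε p :=
    fun p h1 h2 => hL p (by linarith) h2
  refine ⟨δ', hδ'0, (1 / 2 - ε) / max C 1, div_pos (by linarith) (lt_max_of_lt_right one_pos),
    fun p hne hpδ => ?_⟩
  rcases lt_or_gt_of_ne hne with hp | hp
  · exact kesten_lower_of_lt_half_gen hε (hQ0 r₀) hb hδ'δ hδ'4 hL' hp hpδ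
  · -- `p > 1/2`: apply the previous case to `1 - p`
    have hq : ((σ p : unitInterval) : ℝ) < 1 / 2 := by
      rw [unitInterval.coe_symm_eq]; linarith
    have hqδ : |((σ p : unitInterval) : ℝ) - 1 / 2| < δ' := by
      rw [unitInterval.coe_symm_eq, show (1 : ℝ) - p - 1 / 2 = -((p : ℝ) - 1 / 2) by ring,
        abs_neg]
      exact hpδ
    have h := kesten_lower_of_lt_half_gen hε (hQ0 r₀) hb hδ'δ hδ'4 hL' hq hqδ
    rw [charLength_symm, unitInterval.coe_symm_eq,
      show (1 : ℝ) - p - 1 / 2 = -((p : ℝ) - 1 / 2) by ring, abs_neg] at h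
    exact h


/-! ### The rhombus pivotal count with the critical alternating kernel, both sides of `1/2` -/

/-- **The two-sided rhombus pivotal count with the critical alternating kernel from `(hsepA)`,
`(hLB)`, `(hS)`** (Werner 2009, Lemma 6.2 read for the rhombus, composed with Lemma 6.3, both for
the alternating `π̂`; Nolin 2008, §7.3, proof of Prop. 34, last display, and Remark 35):
`c N² π̂^alt_{1/2}(r₀, N) ≤ Σ_{v ∈ [0,N]²} P_t(v pivotal) ≤ C N² π̂^alt_{1/2}(r₀, N)` for
`1/2 ≤ t < 1/2 + δ`, `n₁ ≤ N`, `N ≤ L(t, ε)` if `t > 1/2`. The lower half from alternating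
separation (`rhombusPivotalSum_lower_alt_of_altSeparation`), the upper half from
quasi-multiplicativity — itself from separation, `altFourArm_quasiMult_of_altSeparation` — and the
a priori bound (`rhombusPivotalSum_upper_alt`), the passage to the critical kernel by the stability
`(hS)` (`altRhombusPivotal_of_altLemma62_of_altLemma63`). [cite: WernerPCMI2009, Lecture 6, Lemma 6.2, Cor. 6.2, Lemma 6.3] [cite: Nolin2008, §7.3, proof of Prop. 34 (last display) and Remark 35; Thm. 11, Prop. 17, Thm. 27 (arXiv 0711.4948: Prop. 32, Remark 34, Thm. 10, Prop. 16, Thm. 26)] -/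
theorem altRhombusPivotal_of_altSeparation
    (hsepA : ∃ ε₁ > (0 : ℝ), ∀ ⦃ε : ℝ⦄, 0 < ε → ε < ε₁ →
      ∃ n₀ : ℕ, ∃ δ > (0 : ℝ), ∃ c > (0 : ℝ),
        ∀ t : unitInterval, 1 / 2 ≤ (t : ℝ) → (t : ℝ) < 1 / 2 + δ →
          ∀ n N : ℕ, n₀ ≤ n → 2 * n ≤ N → (1 / 2 < (t : ℝ) → N ≤ charLengthW ε t) →
            c * altFourArmProbAt t n N ≤ (triSitePercolation t).real (sepFourArm n N))
    (hLB : ∃ ε₁ > (0 : ℝ), ∀ ⦃ε : ℝ⦄, 0 < ε → ε < ε₁ →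
      ∃ r₁ : ℕ, ∃ δ > (0 : ℝ), ∃ β > (0 : ℝ), ∃ c > (0 : ℝ),
        ∀ t : unitInterval, 1 / 2 ≤ (t : ℝ) → (t : ℝ) < 1 / 2 + δ →
          ∀ m n : ℕ, r₁ ≤ m → m ≤ n → (1 / 2 < (t : ℝ) → n ≤ charLengthW ε t) →
            c * ((m : ℝ) / n) ^ (2 - β) ≤ altFourArmProbAt t m n)
    (hS : ∃ ε₁ > (0 : ℝ), ∀ ⦃ε : ℝ⦄, 0 < ε → ε < ε₁ →
      ∃ r₁ : ℕ, ∀ r₀ ≥ r₁, ∃ n₁ : ℕ, ∃ δ > (0 : ℝ), ∃ c > (0 : ℝ), ∃ C : ℝ,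
        ∀ t : unitInterval, 1 / 2 ≤ (t : ℝ) → (t : ℝ) < 1 / 2 + δ →
          ∀ N : ℕ, n₁ ≤ N → (1 / 2 < (t : ℝ) → N ≤ charLengthW ε t) →
            c * altFourArmProbAt half r₀ N ≤ altFourArmProbAt t r₀ N ∧
              altFourArmProbAt t r₀ N ≤ C * altFourArmProbAt half r₀ N) :
    ∃ ε₁ > (0 : ℝ), ∀ ⦃ε : ℝ⦄, 0 < ε → ε < ε₁ →
      ∃ r₁ : ℕ, ∀ r₀ ≥ r₁, ∃ n₁ : ℕ, ∃ δ > (0 : ℝ), ∃ c > (0 : ℝ), ∃ C : ℝ,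
        ∀ t : unitInterval, 1 / 2 ≤ (t : ℝ) → (t : ℝ) < 1 / 2 + δ →
          ∀ N : ℕ, n₁ ≤ N → (1 / 2 < (t : ℝ) → N ≤ charLengthW ε t) →
            c * ((N : ℝ) ^ 2 * altFourArmProbAt half r₀ N) ≤ rhombusPivotalSum t N ∧
              rhombusPivotalSum t N ≤ C * ((N : ℝ) ^ 2 * altFourArmProbAt half r₀ N) := by
  have hQM := altFourArm_quasiMult_of_altSeparation hsepA
  refine altRhombusPivotal_of_altLemma62_of_altLemma63 ?_ hS
  -- the two halves of the alternating Lemma 6.2 for the rhombus, combined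
  obtain ⟨εL, hεL, HL⟩ := rhombusPivotalSum_lower_alt_of_altSeparation hsepA
  obtain ⟨εU, hεU, HU⟩ := rhombusPivotalSum_upper_alt hQM hLB
  refine ⟨min εL εU, lt_min hεL hεU, fun ε hε hεlt => ?_⟩
  obtain ⟨rL, HL⟩ := HL hε (hεlt.trans_le (min_le_left _ _))
  obtain ⟨rU, HU⟩ := HU hε (hεlt.trans_le (min_le_right _ _))
  refine ⟨max rL rU, fun r₀ hr₀ => ?_⟩
  obtain ⟨nL, δL, hδL, c, hc, HL⟩ := HL r₀ ((le_max_left _ _).trans hr₀)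
  obtain ⟨nU, δU, hδU, C, HU⟩ := HU r₀ ((le_max_right _ _).trans hr₀)
  refine ⟨max nL nU, min δL δU, lt_min hδL hδU, c, hc, C, fun t ht1 ht2 N hN hNL => ⟨?_, ?_⟩⟩
  · exact HL t ht1 (by linarith [min_le_left δL δU]) N ((le_max_left _ _).trans hN) hNL
  · exact HU t ht1 (by linarith [min_le_right δL δU]) N ((le_max_right _ _).trans hN) hNL

/-- **The two-sided count on both sides of `1/2`, below Nolin's length, at every level `ε > 0`.**
From the one-sided statement below Werner's length for small levels: for `t < 1/2` pass to `1 - t`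
(`rhombusPivotalSum_symm`: the pivotal sum of the rhombus is invariant under `t ↦ 1 - t`;
`charLength_symm`), and use `L_ε(t) ≤ L(t, ε')` for `ε' = min ε (ε₁/2) ≤ ε`
(`charLength_le_charLengthW_of_le`). Output shape: that of the hypotheses of
`kesten_upper_at_of_pivotal_lower_gen` / `kesten_lower_at_of_pivotal_upper_gen`. [cite: Nolin2008, §7.3, Remark 35 and proof of Prop. 34 (arXiv 0711.4948: Remark 34, Prop. 32); §3.1 (L_ε(p) = L_ε(1-p))] [cite: WernerPCMI2009, Lecture 6, Lemma 6.2 with Lemma 6.3] -/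
theorem altRhombusPivotal_twoSided_nolin
    (hPS : ∃ ε₁ > (0 : ℝ), ∀ ⦃ε : ℝ⦄, 0 < ε → ε < ε₁ →
      ∃ r₁ : ℕ, ∀ r₀ ≥ r₁, ∃ n₁ : ℕ, ∃ δ > (0 : ℝ), ∃ c > (0 : ℝ), ∃ C : ℝ,
        ∀ t : unitInterval, 1 / 2 ≤ (t : ℝ) → (t : ℝ) < 1 / 2 + δ →
          ∀ N : ℕ, n₁ ≤ N → (1 / 2 < (t : ℝ) → N ≤ charLengthW ε t) →
            c * ((N : ℝ) ^ 2 * altFourArmProbAt half r₀ N) ≤ rhombusPivotalSum t N ∧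
              rhombusPivotalSum t N ≤ C * ((N : ℝ) ^ 2 * altFourArmProbAt half r₀ N))
    {ε : ℝ} (hε : 0 < ε) :
    ∃ r₁ : ℕ, ∀ r₀ ≥ r₁, ∃ n₁ : ℕ, ∃ δ > (0 : ℝ), ∃ c > (0 : ℝ), ∃ C : ℝ,
      ∀ t : unitInterval, |(t : ℝ) - 1 / 2| < δ →
        ∀ N : ℕ, n₁ ≤ N → ((t : ℝ) ≠ 1 / 2 → N ≤ charLength ε t) →
          c * ((N : ℝ) ^ 2 * altFourArmProbAt half r₀ N) ≤ rhombusPivotalSum t N ∧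
            rhombusPivotalSum t N ≤ C * ((N : ℝ) ^ 2 * altFourArmProbAt half r₀ N) := by
  obtain ⟨ε₁, hε₁, H⟩ := hPS
  set ε' : ℝ := min ε (ε₁ / 2) with hε'
  have hε'0 : 0 < ε' := lt_min hε (half_pos hε₁)
  have hε'ε : ε' ≤ ε := min_le_left _ _
  have hε'1 : ε' < ε₁ := (min_le_right _ _).trans_lt (half_lt_self hε₁)
  obtain ⟨r₁, H⟩ := H hε'0 hε'1
  refine ⟨r₁, fun r₀ hr₀ => ?_⟩
  obtain ⟨n₁, δ, hδ, c, hc, C, H⟩ := H r₀ hr₀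
  refine ⟨n₁, δ, hδ, c, hc, C, fun t ht N hN hNL => ?_⟩
  rcases le_or_gt (1 / 2 : ℝ) t with hge | hlt
  · -- `t ≥ 1/2`
    have ht2 : (t : ℝ) < 1 / 2 + δ := by have := (abs_sub_lt_iff.1 ht).1; linarith
    exact H t hge ht2 N hN fun hgt =>
      (hNL hgt.ne').trans (charLength_le_charLengthW_of_le hε'0 hε'ε hgt.ne')
  · -- `t < 1/2`: pass to `1 - t`
    have hσ : ((σ t : unitInterval) : ℝ) = 1 - t := unitInterval.coe_symm_eq t
    have hge : 1 / 2 ≤ ((σ t : unitInterval) : ℝ) := by rw [hσ]; linarith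
    have ht2 : ((σ t : unitInterval) : ℝ) < 1 / 2 + δ := by
      rw [hσ]; have := (abs_sub_lt_iff.1 ht).2; linarith
    have hL : 1 / 2 < ((σ t : unitInterval) : ℝ) → N ≤ charLengthW ε' (σ t) := fun hgt => by
      have h1 : N ≤ charLength ε t := hNL hlt.ne
      rw [← charLength_symm ε t] at h1
      exact h1.trans (charLength_le_charLengthW_of_le hε'0 hε'ε hgt.ne')
    have h := H (σ t) hge ht2 N hN hL
    rwa [rhombusPivotalSum_symm] at h

/-- **Kesten's relation with the critical alternating kernel**: from the two-sided rhombus pivotal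
count with `π̂^alt_{1/2}`, (i) `|p - 1/2| · L_ε(p)² · π̂^alt_{1/2}(r₀, L_ε(p)) ≤ C` for `ε < 1/2`,
`p ≠ 1/2` near `1/2`, `r₀` large (Nolin 2008, Remark 35; Werner 2009, Cor. 6.3), and (ii)
`c(ε) ≤ |p - 1/2| · L_ε(p)² · π̂^alt_{1/2}(r₀, L_ε(p))` with `c(ε) > 0` for EVERY `ε ∈ (0, 1/2)`
(Nolin 2008, Prop. 34, "for any fixed `ε`"; Werner 2009, display after Lemma 6.3) — the hypotheses
`hKup`, `hKlow` of `Nolin2008_cor41_of_kernel` / `Nolin2008_theta_asymp_of_kernel` for the kernel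
`Q = altFourArmProbAt half`. [cite: Nolin2008, §7.3, Prop. 34 and Remark 35 (arXiv 0711.4948: Prop. 32, Remark 34)] [cite: WernerPCMI2009, Lecture 6, Cor. 6.3 and display after Lemma 6.3] [cite: KestenScalingCMP1987, (4.5)] -/
theorem kestenBounds_alt_of_altRhombusPivotal
    (hPS : ∃ ε₁ > (0 : ℝ), ∀ ⦃ε : ℝ⦄, 0 < ε → ε < ε₁ →
      ∃ r₁ : ℕ, ∀ r₀ ≥ r₁, ∃ n₁ : ℕ, ∃ δ > (0 : ℝ), ∃ c > (0 : ℝ), ∃ C : ℝ,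
        ∀ t : unitInterval, 1 / 2 ≤ (t : ℝ) → (t : ℝ) < 1 / 2 + δ →
          ∀ N : ℕ, n₁ ≤ N → (1 / 2 < (t : ℝ) → N ≤ charLengthW ε t) →
            c * ((N : ℝ) ^ 2 * altFourArmProbAt half r₀ N) ≤ rhombusPivotalSum t N ∧
              rhombusPivotalSum t N ≤ C * ((N : ℝ) ^ 2 * altFourArmProbAt half r₀ N)) :
    (∃ ε₁ > (0 : ℝ), ∀ ⦃ε : ℝ⦄, 0 < ε → ε < ε₁ → ∃ r₁ : ℕ, ∀ r₀ ≥ r₁, ∃ δ > (0 : ℝ),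
      ∃ C : ℝ, ∀ p : unitInterval, (p : ℝ) ≠ 1 / 2 → |(p : ℝ) - 1 / 2| < δ →
        |(p : ℝ) - 1 / 2| * (charLength ε p : ℝ) ^ 2 * altFourArmProbAt half r₀ (charLength ε p) ≤ C) ∧
    (∀ ⦃ε : ℝ⦄, 0 < ε → ε < 1 / 2 → ∃ r₁ : ℕ, ∀ r₀ ≥ r₁, ∃ δ > (0 : ℝ), ∃ c > (0 : ℝ),
      ∀ p : unitInterval, (p : ℝ) ≠ 1 / 2 → |(p : ℝ) - 1 / 2| < δ →
        c ≤ |(p : ℝ) - 1 / 2| * (charLength ε p : ℝ) ^ 2 * altFourArmProbAt half r₀ (charLength ε p)) := by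
  have hQ0 : ∀ r N : ℕ, 0 ≤ altFourArmProbAt half r N := fun r N => altFourArmProbAt_nonneg half r N
  constructor
  · refine ⟨1 / 2, one_half_pos, fun ε hε hε2 => ?_⟩
    obtain ⟨r₁, H⟩ := altRhombusPivotal_twoSided_nolin hPS hε
    refine kesten_upper_at_of_pivotal_lower_gen (Q := fun r N => altFourArmProbAt half r N) hε hε2 hQ0
      ⟨r₁, fun r₀ hr₀ => ?_⟩
    obtain ⟨n₁, δ, hδ, c, hc, C, H⟩ := H r₀ hr₀
    exact ⟨n₁, δ, hδ, c, hc, fun t ht N hN hNL => (H t ht N hN hNL).1⟩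
  · intro ε hε hε2
    obtain ⟨r₁, H⟩ := altRhombusPivotal_twoSided_nolin hPS hε
    refine kesten_lower_at_of_pivotal_upper_gen (Q := fun r N => altFourArmProbAt half r N) hε hε2 hQ0
      ⟨r₁, fun r₀ hr₀ => ?_⟩
    obtain ⟨n₁, δ, hδ, c, hc, C, H⟩ := H r₀ hr₀
    exact ⟨n₁, δ, hδ, C, fun t ht N hN hNL => (H t ht N hN hNL).2⟩

/-! ### The assemblies -/

/-- **Nolin's Cor. 41 at every `ε ∈ (0, 1/2)` from `(hsepA)`, `(hLB)`, `(hS)`** (Nolin 2008, §7.4,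
Cor. 41 [arXiv 0711.4948: Cor. 39]: `θ(p) ≍ P_p(0 ↔ ∂S_{L_ε(p)})`, through the equivalence of
lengths Cor. 37 and Kesten's relation Prop. 34): `Nolin2008_cor41_of_kernel` at the kernel
`Q = π̂^alt_{1/2}` with `kestenBounds_alt_of_altRhombusPivotal`. [cite: Nolin2008, §7.4 Cor. 41, §7.3 Cor. 37 and Prop. 34 (arXiv 0711.4948: Cor. 39, Cor. 35, Prop. 32)] -/
theorem Nolin2008_cor41_of_altSeparation
    (hsepA : ∃ ε₁ > (0 : ℝ), ∀ ⦃ε : ℝ⦄, 0 < ε → ε < ε₁ →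
      ∃ n₀ : ℕ, ∃ δ > (0 : ℝ), ∃ c > (0 : ℝ),
        ∀ t : unitInterval, 1 / 2 ≤ (t : ℝ) → (t : ℝ) < 1 / 2 + δ →
          ∀ n N : ℕ, n₀ ≤ n → 2 * n ≤ N → (1 / 2 < (t : ℝ) → N ≤ charLengthW ε t) →
            c * altFourArmProbAt t n N ≤ (triSitePercolation t).real (sepFourArm n N))
    (hLB : ∃ ε₁ > (0 : ℝ), ∀ ⦃ε : ℝ⦄, 0 < ε → ε < ε₁ →
      ∃ r₁ : ℕ, ∃ δ > (0 : ℝ), ∃ β > (0 : ℝ), ∃ c > (0 : ℝ),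
        ∀ t : unitInterval, 1 / 2 ≤ (t : ℝ) → (t : ℝ) < 1 / 2 + δ →
          ∀ m n : ℕ, r₁ ≤ m → m ≤ n → (1 / 2 < (t : ℝ) → n ≤ charLengthW ε t) →
            c * ((m : ℝ) / n) ^ (2 - β) ≤ altFourArmProbAt t m n)
    (hS : ∃ ε₁ > (0 : ℝ), ∀ ⦃ε : ℝ⦄, 0 < ε → ε < ε₁ →
      ∃ r₁ : ℕ, ∀ r₀ ≥ r₁, ∃ n₁ : ℕ, ∃ δ > (0 : ℝ), ∃ c > (0 : ℝ), ∃ C : ℝ,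
        ∀ t : unitInterval, 1 / 2 ≤ (t : ℝ) → (t : ℝ) < 1 / 2 + δ →
          ∀ N : ℕ, n₁ ≤ N → (1 / 2 < (t : ℝ) → N ≤ charLengthW ε t) →
            c * altFourArmProbAt half r₀ N ≤ altFourArmProbAt t r₀ N ∧
              altFourArmProbAt t r₀ N ≤ C * altFourArmProbAt half r₀ N) :
    Nolin2008_cor41 := by
  have hQM := altFourArm_quasiMult_of_altSeparation hsepA
  obtain ⟨hKup, hKlow⟩ :=
    kestenBounds_alt_of_altRhombusPivotal (altRhombusPivotal_of_altSeparation hsepA hLB hS)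
  exact Nolin2008_cor41_of_kernel (Q := fun r R => altFourArmProbAt half r R)
    (fun _ _ => altFourArmProbAt_nonneg _ _ _) (critAltFourArmProb_quasiMult hQM)
    (critAltFourArmProb_lowerBound hLB) hKup hKlow

/-- **`θ(p) ≍ π₁(L_ε(p))` for every `ε ∈ (0, 1/2)` (`Nolin2008_theta_asymp`) from the one-arm
stability below `L(p)` and the three alternating statements `(hsepA)`, `(hLB)`, `(hS)`** (Nolin
2008, §7.4, eq. (7.25) with Cor. 41 and Thm. 27 [arXiv 0711.4948: display after Cor. 39; Thm. 26];
Werner 2009, Lecture 6, "End of the proof"; Kesten 1987, Thm. 2): Cor. 41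
(`Nolin2008_cor41_of_altSeparation`) and the one-arm stability `Werner2009_oneArm_nearCritical`,
combined by `Nolin2008_theta_asymp_of_oneArm_nearCritical`. The one-arm stability itself follows
from `(hsepA)` and `(hLB)` alone — `Werner2009_oneArm_nearCritical_of_altSeparation hsepA hLB`
(`WernerOneArmStabilityFromAltSeparation.lean`, fleet, 2026-08-15) — so that the fact rests on
the three displayed alternating statements; it is kept as a separate hypothesis `h1` here only to
keep this file's imports light. With Nolin's arm-separation Thm. 11 for `j = 4`, `σ = BWBW` below
`L(p)`, the five-arm a priori bound for the alternating event and Lemma 6.3 for `π̂^alt` as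
theorems, the discharge reads
`Nolin2008_theta_asymp_of_oneArm_of_altSeparation (Werner2009_oneArm_nearCritical_of_altSeparation hsepA hLB) hsepA hLB hS`.
[cite: Nolin2008, §7.4, eq. (7.25), Cor. 41, Thm. 27, Thm. 11 (arXiv 0711.4948: Cor. 39, Thm. 26, Thm. 10)] [cite: WernerPCMI2009, Lecture 6, Prop. 6.1, Lemma 6.3, §5 and end of §5] [cite: KestenScalingCMP1987, Thm. 2] -/
theorem Nolin2008_theta_asymp_of_oneArm_of_altSeparation (h1 : Werner2009_oneArm_nearCritical)
    (hsepA : ∃ ε₁ > (0 : ℝ), ∀ ⦃ε : ℝ⦄, 0 < ε → ε < ε₁ →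
      ∃ n₀ : ℕ, ∃ δ > (0 : ℝ), ∃ c > (0 : ℝ),
        ∀ t : unitInterval, 1 / 2 ≤ (t : ℝ) → (t : ℝ) < 1 / 2 + δ →
          ∀ n N : ℕ, n₀ ≤ n → 2 * n ≤ N → (1 / 2 < (t : ℝ) → N ≤ charLengthW ε t) →
            c * altFourArmProbAt t n N ≤ (triSitePercolation t).real (sepFourArm n N))
    (hLB : ∃ ε₁ > (0 : ℝ), ∀ ⦃ε : ℝ⦄, 0 < ε → ε < ε₁ →
      ∃ r₁ : ℕ, ∃ δ > (0 : ℝ), ∃ β > (0 : ℝ), ∃ c > (0 : ℝ),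
        ∀ t : unitInterval, 1 / 2 ≤ (t : ℝ) → (t : ℝ) < 1 / 2 + δ →
          ∀ m n : ℕ, r₁ ≤ m → m ≤ n → (1 / 2 < (t : ℝ) → n ≤ charLengthW ε t) →
            c * ((m : ℝ) / n) ^ (2 - β) ≤ altFourArmProbAt t m n)
    (hS : ∃ ε₁ > (0 : ℝ), ∀ ⦃ε : ℝ⦄, 0 < ε → ε < ε₁ →
      ∃ r₁ : ℕ, ∀ r₀ ≥ r₁, ∃ n₁ : ℕ, ∃ δ > (0 : ℝ), ∃ c > (0 : ℝ), ∃ C : ℝ,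
        ∀ t : unitInterval, 1 / 2 ≤ (t : ℝ) → (t : ℝ) < 1 / 2 + δ →
          ∀ N : ℕ, n₁ ≤ N → (1 / 2 < (t : ℝ) → N ≤ charLengthW ε t) →
            c * altFourArmProbAt half r₀ N ≤ altFourArmProbAt t r₀ N ∧
              altFourArmProbAt t r₀ N ≤ C * altFourArmProbAt half r₀ N) :
    Nolin2008_theta_asymp :=
  Nolin2008_theta_asymp_of_oneArm_nearCritical h1 (Nolin2008_cor41_of_altSeparation hsepA hLB hS)

end Literature.Probability.Percolation

end
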